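import Summits.NavierStokesRegularity.FluidComputer.BlockQuadDrift

/-!
# PSEUDO-ORBIT DELAYED ABRUPT TRANSITION for the quadratic gate (amplitude-uniform)

HONEST FRAMING (page 1): this file belongs to a low prior, high value-of-information experiment
on Tao's machine paradigm; it is NOT a claim that NS blows up. It is design-level calculus about
the planar quadratic design field `quadVF k η (a,b) = (−kηab, ka²)` (`BlockQuadGate.lean`) and its
`ε`-pseudo-orbits (`BlockQuadDrift.lean`); nothing here is a statement about Navier–Stokes.

WHAT IS PROVED. The circuit half of the open machine (`BlockOpenWindow.lean`) asks the idea-bound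
side for `δsh`-SHADOWING of the design orbit over a whole tick and certifies the delayed abrupt
transition (`DatO`) for the EXACT orbit; the only generic way to get shadowing from a pointwise
leakage (defect) bound is Grönwall, and for the quadratic gate that budget is void
(`BlockQuadBudget.lean`: no budget at all on the open window, admissible defect `≤ 2·10⁻¹¹`
already on the bounded window `a ≤ 2`). Using the three amplitude-uniform pseudo-orbit estimates
of `BlockQuadDrift.lean` (energy band, almost-monotone `b`, gap decay) and a Taylor floor for the
exponential (`exp_ge_poly38`), this file proves

* `quad_pseudoOrbit_datO` — for the lane's windows `Params.reg` (`s = 10`), `η ∈ [1/2, 9/10]`,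
  every coupling `k ≥ 6` and every defect level `ε ≤ 1/400`, EVERY `ε`-pseudo-orbit of
  `quadVF k η` on the tick `[0, 1]` that starts in the open input window `AinO` ends, at time
  `1`, in the open output window `AoutO` (`|a(1)| ≤ 1/4`, `b(1) ≥ 3/2`) — whatever its amplitude.

So the architecture's transition obligation is discharged DIRECTLY from a pointwise defect bound of
ordinary size (`1/400` in readout units, against `≤ 2·10⁻¹¹` and only for `a ≤ 2` through
Grönwall), uniformly in the amplitude: the structure of the quadratic gate (energy conservation,
monotone `b`, self-accelerating crossing) replaces the exponential loss. The constant `1/400` is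
dictated by the slack of the window design at `η = 9/10` (`aLo − δ = 1.45` against
`aLo·√η ≈ 1.423`), not by the dynamics.

WHAT THIS DOES NOT DO. It does not produce a pseudo-orbit from a Navier–Stokes solution: that the
true readout of an NS solution has defect `≤ 1/400` against `quadVF` along a whole tick, uniformly
in the amplitude, is an NS inequality nobody has proved (idea-bound; for a bare two-wavelet pair
presumably false, `BlockDegreeNoGo.lean`/§2g.9 of ASSEMBLY.md), and the junk / spectral-tail
obligations of the tick are untouched. It shows only that, for the quadratic gate, the circuit
half of the residue CAN be re-typed from "shadow the orbit within `1/50`" to "pointwise defect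
`≤ 1/400`" without any amplitude-dependent loss — the re-typed local layer is successor work.
[cite: Tao2016AveragedNS, §1.3 pp. 10–11 (the machine paradigm)]
-/

open Set Filter Topology

namespace Summit.NavierStokesRegularity.FluidComputer

open Literature.Analysis.FluidPDE Literature.Analysis.FluidPDE.FluidComputer

namespace BlockDesign

/-! ## Taylor floor for the exponential -/

/-- `x³/6 + x⁴/24 + ⋯ + x⁸/40320 ≤ eˣ` for `x ≥ 0` (partial Taylor sum). [folklore] -/
theorem exp_ge_poly38 {x : ℝ} (hx : 0 ≤ x) :
    x ^ 3 / 6 + x ^ 4 / 24 + x ^ 5 / 120 + x ^ 6 / 720 + x ^ 7 / 5040 + x ^ 8 / 40320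
      ≤ Real.exp x := by
  have h := Real.sum_le_exp_of_nonneg hx 9
  norm_num [Finset.sum_range_succ, Nat.factorial] at h
  have h0 : 0 ≤ 1 + x + x ^ 2 / 2 := by positivity
  linarith

/-! ## Main theorem: pseudo-orbit delayed abrupt transition, amplitude-uniform -/

variable {S : CascadeSpecs}

/-- PSEUDO-ORBIT DAT FOR THE QUADRATIC GATE (amplitude-uniform, defect of ordinary size).
For the lane's windows `Params.reg` (`s = 10`; `aLo = 3/2`, `c0 = 3/20`, `δ = 1/20`,
`σsp = 1/4`), `η ∈ [1/2, 9/10]`, every coupling `k ≥ 6` and every `ε ≤ 1/400`: if `z` is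
continuous on `[0, 1]`, has right derivative `w t` with `‖w t − quadVF k η (z t)‖ ≤ ε` at every
`t ∈ [0, 1)`, and `z 0 ∈ AinO` (`a > 1.45`, `|b| < 0.2`, ANY amplitude), then `z 1 ∈ AoutO`
(`|a(1)| ≤ 1/4`, `b(1) ≥ 3/2`). Proof: energy band (`W ≥ 0.995(1 + W₀) − 1`), `b ≥ −0.2025`,
gap decay with `κ = 0.85·k√η·R_low ≥ 3.6 R_low ≥ 5`, `a(1)² = p(R + √ηb) ≤ 2R·p ≤ 3/50`
(Taylor floor `eˣ ≥ 4.79 x²` for `x ≥ 5`), and `ηb(1)² = W(1) − a(1)² > 9η/4`. The corner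
`η = 9/10`, `a₀ → 1.45`, `b₀ = 0` is tight by design of the windows. Nothing about NS. [folklore] -/
theorem quad_pseudoOrbit_datO (hS : S.lam0 = 1) (hη : 1 / 2 ≤ S.eta) (hη2 : S.eta ≤ 9 / 10)
    {k : ℝ} (hk : 6 ≤ k) {ε : ℝ} (hε : ε ≤ 1 / 400) {z w : ℝ → ℝ × ℝ}
    (hcont : ContinuousOn z (Icc 0 1))
    (hderiv : ∀ t ∈ Ico (0 : ℝ) 1, HasDerivWithinAt z (w t) (Ici t) t)
    (hdef : ∀ t ∈ Ico (0 : ℝ) 1, ‖w t - quadVF k S.eta (z t)‖ ≤ ε)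
    (h0 : z 0 ∈ AinO (Params.reg S hS hη)) :
    z 1 ∈ AoutO (Params.reg S hS hη) := by
  obtain ⟨ha0, hb0⟩ := AinO_bounds h0
  change (3 : ℝ) / 2 - 1 / 20 < (z 0).1 at ha0
  change |(z 0).2| < (3 : ℝ) / 20 + 1 / 20 at hb0
  have hI0 : (0 : ℝ) ∈ Ico (0 : ℝ) 1 := ⟨le_rfl, zero_lt_one⟩
  have hI1 : (1 : ℝ) ∈ Icc (0 : ℝ) 1 := ⟨zero_le_one, le_rfl⟩
  have hε0 : 0 ≤ ε := (norm_nonneg _).trans (hdef 0 hI0)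
  have hη0 : 0 ≤ S.eta := S.eta_pos.le
  have hη1 : S.eta ≤ 1 := S.eta_le_one
  have hk0 : 0 ≤ k := by linarith only [hk]
  have hs0 : 0 ≤ Real.sqrt S.eta := Real.sqrt_nonneg _
  have hs1 : Real.sqrt S.eta ≤ 1 := Real.sqrt_le_one.mpr hη1
  have hs7 : (7071 : ℝ) / 10000 ≤ Real.sqrt S.eta := by
    rw [Real.le_sqrt' (by norm_num)]; norm_num; linarith only [hη]
  -- initial energy `m > 2.1025`
  set m := pairEnergy S.eta (z 0) with hm
  have hm_gt : (841 : ℝ) / 400 < m := by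
    have h2 : (841 : ℝ) / 400 < (z 0).1 ^ 2 := by nlinarith only [ha0]
    have h3 : 0 ≤ S.eta * (z 0).2 ^ 2 := mul_nonneg hη0 (sq_nonneg _)
    have h4 : m = (z 0).1 ^ 2 + S.eta * (z 0).2 ^ 2 := rfl
    linarith only [h2, h3, h4]
  have hm0 : 0 ≤ 1 + m := by linarith only [hm_gt]
  -- the energy band on the tick, in rational form
  have band := pseudo_energy_band hη0 hη1 k hcont hderiv hdef
  have hWlo : ∀ t ∈ Icc (0 : ℝ) 1, (199 * m - 1) / 200 ≤ pairEnergy S.eta (z t) := by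
    intro t ht
    have h1 := (band t ht).1
    have he : 1 - 2 * ε * t ≤ Real.exp (-(2 * ε) * t) := by
      have := Real.add_one_le_exp (-(2 * ε) * t); linarith only [this]
    have h2 : (1 + m) * (1 - 2 * ε * t) ≤ (1 + m) * Real.exp (-(2 * ε) * t) :=
      mul_le_mul_of_nonneg_left he hm0
    have h3 : 2 * ε * t ≤ 1 / 200 := by nlinarith only [ht.1, ht.2, hε, hε0]
    have h4 : (1 + m) * (2 * ε * t) ≤ (1 + m) * (1 / 200) := mul_le_mul_of_nonneg_left h3 hm0
    linarith only [h1, h2, h4]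
  have hWhi : ∀ t ∈ Icc (0 : ℝ) 1, pairEnergy S.eta (z t) ≤ (200 * m + 1) / 199 := by
    intro t ht
    have h1 := (band t ht).2
    have hx1 : 2 * ε * t ≤ 1 / 200 := by nlinarith only [ht.1, ht.2, hε, hε0]
    have he : Real.exp (2 * ε * t) ≤ 200 / 199 :=
      calc Real.exp (2 * ε * t) ≤ Real.exp (1 / 200) := Real.exp_le_exp.2 hx1
        _ ≤ 1 / (1 - 1 / 200) :=
          Real.exp_bound_div_one_sub_of_interval (by norm_num) (by norm_num)
        _ = 200 / 199 := by norm_num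
    have h2 : (1 + m) * Real.exp (2 * ε * t) ≤ (1 + m) * (200 / 199) :=
      mul_le_mul_of_nonneg_left he hm0
    linarith only [h1, h2]
  -- the energy floor `r = √L`, `L > 2.0869`, `r > 1.44`
  set L := (199 * m - 1) / 200 with hL
  have hL_gt : (166959 : ℝ) / 80000 < L := by rw [hL]; linarith only [hm_gt]
  set r := Real.sqrt L with hr
  have hr2 : r ^ 2 = L := Real.sq_sqrt (by linarith only [hL_gt])
  have hr_gt : (36 : ℝ) / 25 < r := by
    rw [hr, Real.lt_sqrt (by norm_num)]; norm_num; linarith only [hL_gt]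
  have hr0 : 0 < r := by linarith only [hr_gt]
  have hRge : ∀ t ∈ Icc (0 : ℝ) 1, r ≤ qRad S.eta (z t) := fun t ht =>
    Real.sqrt_le_sqrt (hWlo t ht)
  have hWne : ∀ t ∈ Ico (0 : ℝ) 1, pairEnergy S.eta (z t) ≠ 0 := fun t ht => by
    have := hWlo t (Ico_subset_Icc_self ht)
    exact (by linarith only [this, hL_gt, hL] : 0 < pairEnergy S.eta (z t)).ne'
  -- the floor of the second component on the tick
  have hbge : ∀ t ∈ Ico (0 : ℝ) 1, -(81 : ℝ) / 400 ≤ (z t).2 := by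
    intro t ht
    have h := pseudo_snd_lower hk0 hcont hderiv hdef t (Ico_subset_Icc_self ht)
    have hb := (abs_lt.1 hb0).1
    nlinarith only [h, hb, ht.1, ht.2, hε, hε0]
  -- the decay rate `κ = 0.85 k √η r ≥ 3.6 r > 5`
  set κ := 17 / 20 * k * Real.sqrt S.eta * r with hκ
  have hκ_ge : (18 : ℝ) / 5 * r ≤ κ := by
    have hks : 6 * ((7071 : ℝ) / 10000) ≤ k * Real.sqrt S.eta := mul_le_mul hk hs7 (by norm_num) hk0
    have : (18 : ℝ) / 5 ≤ 17 / 20 * k * Real.sqrt S.eta := by linarith only [hks]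
    rw [hκ]; exact mul_le_mul_of_nonneg_right this hr0.le
  have hκ5 : (5 : ℝ) ≤ κ := by linarith only [hκ_ge, hr_gt]
  have hκ0 : 0 < κ := by linarith only [hκ5]
  have hκle : ∀ t ∈ Ico (0 : ℝ) 1,
      κ ≤ k * Real.sqrt S.eta * (qRad S.eta (z t) + Real.sqrt S.eta * (z t).2) := by
    intro t ht
    have hR := hRge t (Ico_subset_Icc_self ht)
    have hb := hbge t ht
    have hsb : -(81 : ℝ) / 400 ≤ Real.sqrt S.eta * (z t).2 := by
      by_cases hbs : 0 ≤ (z t).2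
      · have := mul_nonneg hs0 hbs; linarith only [this]
      · push Not at hbs
        have := mul_nonneg (sub_nonneg.2 hs1) (neg_nonneg.2 hbs.le)
        nlinarith only [this, hb]
    have hks : 0 ≤ k * Real.sqrt S.eta := mul_nonneg hk0 hs0
    have h1 : 17 / 20 * r ≤ qRad S.eta (z t) + Real.sqrt S.eta * (z t).2 := by
      linarith only [hR, hsb, hr_gt]
    calc κ = (k * Real.sqrt S.eta) * (17 / 20 * r) := by rw [hκ]; ring
      _ ≤ (k * Real.sqrt S.eta) * (qRad S.eta (z t) + Real.sqrt S.eta * (z t).2) :=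
        mul_le_mul_of_nonneg_left h1 hks
  -- gap decay at time `1`
  have hgap := pseudo_gap_decay hη0 hη1 k hκ0 hε0 hcont hderiv hdef hWne hκle 1 hI1
  rw [mul_one] at hgap
  set p1 := qRad S.eta (z 1) - Real.sqrt S.eta * (z 1).2 with hp1
  set p0 := qRad S.eta (z 0) - Real.sqrt S.eta * (z 0).2 with hp0
  set R1 := qRad S.eta (z 1) with hR1
  set E := Real.exp (-κ) with hE
  have hE0 : 0 ≤ E := (Real.exp_pos _).le
  -- `p1 ≥ 0` and `a1² = p1 (R1 + √η b1) ≤ 2 R1 p1`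
  have hsb1 := sqrt_mul_abs_snd_le_qRad hη0 (z 1)
  have hsb1' : Real.sqrt S.eta * (z 1).2 ≤ Real.sqrt S.eta * |(z 1).2| :=
    mul_le_mul_of_nonneg_left (le_abs_self _) hs0
  have hp1_nn : 0 ≤ p1 := by rw [hp1]; linarith only [hsb1, hsb1']
  have hid : (z 1).1 ^ 2 = p1 * (R1 + Real.sqrt S.eta * (z 1).2) := by
    have hR2 : R1 ^ 2 = (z 1).1 ^ 2 + S.eta * (z 1).2 ^ 2 :=
      Real.sq_sqrt (pairEnergy_nonneg hη0 _)
    have hse : Real.sqrt S.eta ^ 2 = S.eta := Real.sq_sqrt hη0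
    have h' : p1 * (R1 + Real.sqrt S.eta * (z 1).2)
        = R1 ^ 2 - Real.sqrt S.eta ^ 2 * (z 1).2 ^ 2 := by rw [hp1]; ring
    rw [h', hR2, hse]; ring
  have ha_sq : (z 1).1 ^ 2 ≤ 2 * R1 * p1 := by
    have hle : R1 + Real.sqrt S.eta * (z 1).2 ≤ 2 * R1 := by linarith only [hsb1, hsb1']
    rw [hid]
    calc p1 * (R1 + Real.sqrt S.eta * (z 1).2) ≤ p1 * (2 * R1) :=
          mul_le_mul_of_nonneg_left hle hp1_nn
      _ = 2 * R1 * p1 := by ring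
  -- numeric bounds: `R1 ≤ 1.01 r`, `p0 ≤ 1.005 r + 1/5`
  have hR1_le : R1 ≤ 101 / 100 * r := by
    have hU := hWhi 1 hI1
    have h' : pairEnergy S.eta (z 1) ≤ 10201 / 10000 * r ^ 2 := by
      rw [hr2, hL]; linarith only [hU, hm_gt]
    have h'' : pairEnergy S.eta (z 1) ≤ (101 / 100 * r) ^ 2 := by
      rw [show ((101 : ℝ) / 100 * r) ^ 2 = 10201 / 10000 * r ^ 2 by ring]; exact h'
    calc R1 = Real.sqrt (pairEnergy S.eta (z 1)) := rfl
      _ ≤ Real.sqrt ((101 / 100 * r) ^ 2) := Real.sqrt_le_sqrt h''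
      _ = 101 / 100 * r := Real.sqrt_sq (by linarith only [hr0])
  have hp0_le : p0 ≤ 201 / 200 * r + 1 / 5 := by
    have h1 : Real.sqrt m ≤ 201 / 200 * r := by
      have h' : m ≤ 40401 / 40000 * r ^ 2 := by rw [hr2, hL]; linarith only [hm_gt]
      have h'' : m ≤ (201 / 200 * r) ^ 2 := by
        rw [show ((201 : ℝ) / 200 * r) ^ 2 = 40401 / 40000 * r ^ 2 by ring]; exact h'
      calc Real.sqrt m ≤ Real.sqrt ((201 / 200 * r) ^ 2) := Real.sqrt_le_sqrt h''
        _ = 201 / 200 * r := Real.sqrt_sq (by linarith only [hr0])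
    have h2 : -(Real.sqrt S.eta * (z 0).2) ≤ 1 / 5 :=
      calc -(Real.sqrt S.eta * (z 0).2) ≤ |Real.sqrt S.eta * (z 0).2| := neg_le_abs _
        _ = Real.sqrt S.eta * |(z 0).2| := by rw [abs_mul, abs_of_nonneg hs0]
        _ ≤ 1 * (1 / 5) := mul_le_mul hs1 (by linarith only [hb0]) (abs_nonneg _) zero_le_one
        _ = 1 / 5 := one_mul _
    have h3 : qRad S.eta (z 0) = Real.sqrt m := by rw [hm]; rfl
    rw [hp0, h3]; linarith only [h1, h2]
  -- the exponential: `E · (4.792 κ²) ≤ 1`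
  have hexp : κ ^ 2 * (4792 / 1000) ≤ Real.exp κ := by
    have hq := exp_ge_poly38 hκ0.le
    have hκ2 : 0 ≤ κ ^ 2 := sq_nonneg κ
    have e1 : (5 : ℝ) * κ ^ 2 ≤ κ ^ 3 := by nlinarith only [hκ5, hκ2]
    have p2 : (25 : ℝ) ≤ κ ^ 2 := by nlinarith only [hκ5]
    have p3 : (125 : ℝ) ≤ κ ^ 3 := by nlinarith only [hκ5, p2]
    have p4 : (625 : ℝ) ≤ κ ^ 4 := by nlinarith only [hκ5, p3]
    have p5 : (3125 : ℝ) ≤ κ ^ 5 := by nlinarith only [hκ5, p4]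
    have p6 : (15625 : ℝ) ≤ κ ^ 6 := by nlinarith only [hκ5, p5]
    have e2 : (25 : ℝ) * κ ^ 2 ≤ κ ^ 4 := by nlinarith only [p2, hκ2]
    have e3 : (125 : ℝ) * κ ^ 2 ≤ κ ^ 5 := by nlinarith only [p3, hκ2]
    have e4 : (625 : ℝ) * κ ^ 2 ≤ κ ^ 6 := by nlinarith only [p4, hκ2]
    have e5 : (3125 : ℝ) * κ ^ 2 ≤ κ ^ 7 := by nlinarith only [p5, hκ2]
    have e6 : (15625 : ℝ) * κ ^ 2 ≤ κ ^ 8 := by nlinarith only [p6, hκ2]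
    linarith only [e1, e2, e3, e4, e5, e6, hq, hκ2]
  have hEk : E * (κ ^ 2 * (4792 / 1000)) ≤ 1 := by
    have h := mul_le_mul_of_nonneg_left hexp hE0
    rw [hE, ← Real.exp_add, neg_add_cancel, Real.exp_zero] at h
    rw [hE]; exact h
  -- `p1 ≤ (1.005 r + 0.2) E + 3ε/κ`
  have hp1_le : p1 ≤ (201 / 200 * r + 1 / 5) * E + 3 * ε / κ :=
    calc p1 ≤ p0 * E + 3 * ε / κ := hgap
      _ ≤ (201 / 200 * r + 1 / 5) * E + 3 * ε / κ :=
        add_le_add (mul_le_mul_of_nonneg_right hp0_le hE0) le_rfl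
  -- the main numeric inequality `2 R1 p1 ≤ 3/50`
  have hmain : 2 * R1 * p1 ≤ 3 / 50 := by
    have hr2k : (324 : ℝ) / 25 * r ^ 2 ≤ κ ^ 2 := by
      have := pow_le_pow_left₀ (by linarith only [hr0] : (0 : ℝ) ≤ 18 / 5 * r) hκ_ge 2
      rw [show ((18 : ℝ) / 5 * r) ^ 2 = 324 / 25 * r ^ 2 by ring] at this; exact this
    have hA : r ^ 2 * E ≤ 25 / 324 * (1000 / 4792) := by
      have h1 := mul_le_mul_of_nonneg_right hr2k hE0
      nlinarith only [h1, hEk]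
    have hrE : (36 : ℝ) / 25 * (r * E) ≤ r ^ 2 * E := by
      have := mul_le_mul_of_nonneg_right hr_gt.le (mul_nonneg hr0.le hE0)
      nlinarith only [this]
    have hB : r * (3 * ε / κ) ≤ 5 / 18 * (3 * ε) := by
      rw [mul_div_assoc', div_le_iff₀ hκ0]
      have := mul_le_mul_of_nonneg_right hκ_ge (by linarith only [hε0] : (0 : ℝ) ≤ 3 * ε)
      nlinarith only [this]
    calc 2 * R1 * p1 ≤ 2 * (101 / 100 * r) * p1 := by
          have := mul_le_mul_of_nonneg_right hR1_le hp1_nn; nlinarith only [this]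
      _ ≤ 2 * (101 / 100 * r) * ((201 / 200 * r + 1 / 5) * E + 3 * ε / κ) :=
          mul_le_mul_of_nonneg_left hp1_le (by linarith only [hr0])
      _ = 202 / 100 * (201 / 200 * (r ^ 2 * E) + 1 / 5 * (r * E))
          + 202 / 100 * (r * (3 * ε / κ)) := by ring
      _ ≤ 3 / 50 := by linarith only [hA, hB, hrE, hε, hε0]
  -- first coordinate: `|a(1)| ≤ 1/4`
  have ha2 : (z 1).1 ^ 2 ≤ 3 / 50 := ha_sq.trans hmain
  have ha1 : |(z 1).1| ≤ 1 / 4 := by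
    have h' : (z 1).1 ^ 2 ≤ (1 / 4) ^ 2 := by
      rw [show ((1 : ℝ) / 4) ^ 2 = 1 / 16 by norm_num]; linarith only [ha2]
    have := sq_le_sq.1 h'
    rwa [abs_of_pos (by norm_num : (0 : ℝ) < 1 / 4)] at this
  -- second coordinate: `b(1) ≥ 3/2`
  have hb1 : (3 : ℝ) / 2 ≤ (z 1).2 := by
    have hW1 := hWlo 1 hI1
    have hW1' : pairEnergy S.eta (z 1) = (z 1).1 ^ 2 + S.eta * (z 1).2 ^ 2 := rfl
    have hX : (9 : ℝ) / 4 * S.eta < S.eta * (z 1).2 ^ 2 := by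
      linarith only [hW1, hW1', ha2, hm_gt, hη2, hL]
    have hsq : (9 : ℝ) / 4 < (z 1).2 ^ 2 := by
      by_contra hc
      push Not at hc
      have := mul_le_mul_of_nonneg_left hc hη0
      linarith only [hX, this]
    have hR1r : r ≤ R1 := hRge 1 hI1
    have hp1_lt : p1 < R1 := by
      by_contra hc
      push Not at hc
      have h1 := mul_le_mul_of_nonneg_left hc (by linarith only [hR1r, hr0] : (0 : ℝ) ≤ 2 * R1)
      have h2 : (36 : ℝ) / 25 < R1 := hr_gt.trans_le hR1r
      have h3 := mul_le_mul h2.le h2.le (by norm_num) (by linarith only [h2])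
      linarith only [h1, hmain, h3]
    have hpos' : 0 < Real.sqrt S.eta * (z 1).2 := by
      rw [hp1] at hp1_lt; linarith only [hp1_lt]
    have hpos : 0 < (z 1).2 := by
      by_contra hc
      push Not at hc
      have := mul_le_mul_of_nonneg_left hc hs0
      rw [mul_zero] at this
      linarith only [this, hpos']
    by_contra hc
    push Not at hc
    have := mul_lt_mul'' hc hc hpos.le hpos.le
    linarith only [this, hsq]
  simp only [AoutO, Params.reg, Set.mem_prod, Set.mem_Icc, Set.mem_Ici]
  exact ⟨⟨by linarith only [(abs_le.1 ha1).1], (abs_le.1 ha1).2⟩, hb1⟩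

end BlockDesign

end Summit.NavierStokesRegularity.FluidComputer
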